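import Mathlib
import Summits.NavierStokesRegularity.NavierStokesRegularity.Theorems.EulerZoomLiouvillePowerGaugeEulerLiouvilleSelfSimilarBernoulliSqueezeSobolevGrowth
import Summits.NavierStokesRegularity.NavierStokesRegularity.Theorems.EulerZoomLiouvillePowerGaugeEulerLiouvilleSelfSimilarBernoulliSqueezeSharpPast
import Summits.NavierStokesRegularity.NavierStokesRegularity.Theorems.EulerZoomLiouvillePowerGaugeEulerLiouvilleNeedleRaceMemberPast
import HarnessLib

/-!
# «SUPER-FAST CHANNELS SQUEEZE VOLUME TOO FAST», past half: the SHARP SOBOLEV past-exact / shifted twin — channel threshold `1/((2+ρ)(1+ρ))`,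
# NO PRESSURE CLAUSE (crux `EulerZoomLiouville.PowerGaugeEulerLiouville` = stmt-NavierStokesRegularity-19832; skeleton stratum `IsPastSelfSimilarClassical`, disjunct 4)

Route №10 `EulerZoomLiouville` (NavierStokesRegularity); width seat ns-ezl-w5 g2.  The past twin of the LEAD's
`Loc.selfSimilar_ae_eq_zero_of_vorticalFastChannelC2_profile_sharp` (p639126) and the threshold-lowered successor of this seat's g0
`Past.selfSimilar_ae_eq_zero_of_vorticalSuperFastChannelC2_profile_past` (p635810, `c₁ > 3/((2+ρ)(1+2ρ))`, wired in v59).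

* `Loc.volume_bernoulliHigh_inter_far_le_sobolev_of_growth` — THE HIGH BERNOULLI SETS ARE SOBOLEV-THIN (`m = 3+3ρ`) FROM GROWTH-FORM DATA, no pressure clause:
  `(V, P′)` a class-rate CIV (3.3) profile of linear growth with `A`/`E` growths (all scales, real constants) and a measurable `P = P′ + c₀` a.e. with
  `∫_{B_R}|P|^{3/2} ≤ C_D R^{2−2ρ}` (`R ≥ L₁`) ⇒ `vol({h < ℋ_{P′}} ∩ {R ≤ ‖y‖}) ≤ C′R^{−(3+3ρ)}` for `R ≥ R₂(h)`; far high set ⊆ fast ∪ pressure-high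
  (this seat's g0 pointwise `Loc.norm_ge_of_bernoulliHigh_of_pressure_le`), the LEAD's Sobolev fast-set thinness `Loc.volume_fastSet_inter_far_le_sobolev` (p636011)
  and `Loc.volume_pressureHigh_inter_far_le_sobolev_of_growth` (`…SqueezeSobolevGrowth`).
* `Past.profile_eq_zero_of_vorticalFastChannelC2_sharp` / **`Past.selfSimilar_ae_eq_zero_of_vorticalFastChannelC2_profile_sharp_past`** — a class member
  (`0 < ρ ≤ ½`) exactly self-similar about `(T, x₀)` for `τ < T₁` (`T₁ ≤ 0`, `T₁ ≤ T`) whose `C²` velocity profile has linear growth and, for every classical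
  pressure `P′` and every level `h`, a radius beyond which every VORTICAL point of `{ℋ_{P′} > h}` has `⟪y, γy + V y⟫ ≤ −c₁‖y‖²` with ONE rate
  `c₁ > 1/((2+ρ)(1+ρ))` — NO pressure clause — is trivial.  Dictionary: far-past extension (`Shifted.isDistributional_selfSimilarCollapse_of_past`), classical
  pressure (`Past.exists_isSelfSimilarEulerProfile`), bridge `P = P′ + c₀` a.e. on the extension, `A`-growth (`Shifted.profile_energy_growth_of_gaugeA_past` +
  `Loc.real_growth_of_growth_le`), `E`-growth of `∇V` (ns-ezl-w2 g3 `NeedleRace.lintegral_fderiv_sq_ball_le_of_past` + `Loc.real_growth_of_growth_le`),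
  `D`-growth (`Past.profile_pressure_growth_of_gaugeD_past`), thinness above, race `3γ < c₁(3+3ρ)`, vortical squeeze
  `Loc.curl_eq_zero_of_vorticalFastChannel_of_thin` (this seat's g0 p635086), past irrotational stratum `Past.profile_eq_zero_of_irrotationalC2`.

For the skeleton (LEAD): `IsPastSelfSimilarClassical`'s fast-channel disjunct can now read `c₁ > 1/((2+ρ)(1+ρ))` with the filler
`Past.selfSimilar_ae_eq_zero_of_vorticalFastChannelC2_profile_sharp_past` (argument list = p635810's).
HONEST LABEL: PARTIAL model-class stratum (past form; linear growth; uniformly fast far vortical high set).  WHAT THIS IS NOT: not NS, not E — 19832 is a crux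
CLASS on the MODEL lattice (E/NS strata) and stays OPEN; NS regularity is NOT proved. [folklore; ConstantinIgnatovaVicol2026Putative §3.4; GNS inequality]
-/

noncomputable section

-- flat `Theorems/<Route><Decl>…` files of one crux share the namespace of the crux (tree convention)
set_option linter.dupNamespace false

open MeasureTheory Set Filter Topology Metric Function InnerProductSpace TopologicalSpace
open scoped RealInnerProductSpace NNReal ENNReal ContDiff

namespace Summit.NavierStokesRegularity.NavierStokesRegularity.Theorems.PowerGaugeEulerLiouville

open Literature.Analysis Literature.Analysis.FluidPDE Literature.Analysis.FunctionSpaces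

/-! ### The high Bernoulli sets are Sobolev-thin from growth-form data — no pressure clause -/

/-- **THE HIGH BERNOULLI SETS OF A LINEAR-GROWTH PROFILE ARE SOBOLEV-THIN, rate `m = 3+3ρ`, FROM GROWTH-FORM DATA AND WITHOUT ANY PRESSURE CLAUSE.**
`0 < ρ`, `γ = 1/(2+ρ)`; `(V, P′)` a CIV (3.3) profile of linear growth `‖V y‖ ≤ K₁(1+‖y‖)` with `∫_{B_L}|V|² ≤ c_A L^{1−2ρ}`, `∫_{B_L}‖∇V‖² ≤ c_E L^{1−ρ}`
(`L > 0`); `P = P′ + c₀` a.e. with `∫_{B_R}|P|^{3/2} ≤ C_D R^{2−2ρ}` for `R ≥ L₁`.  Then for every level `h` there are `C′` and `R₂ > 0` with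
`vol({h < ℋ_{P′}} ∩ {R ≤ ‖y‖}) ≤ C′ R^{−(3+3ρ)}` for `R ≥ R₂` — the `hthin` input of the (C2) squeeze with `m = 3+3ρ`. [folklore; GNS inequality] -/
theorem Loc.volume_bernoulliHigh_inter_far_le_sobolev_of_growth {ρ : ℝ} (hρ : 0 < ρ)
    {V : EuclideanSpace ℝ (Fin 3) → EuclideanSpace ℝ (Fin 3)} {P' : EuclideanSpace ℝ (Fin 3) → ℝ}
    (hprof : IsSelfSimilarEulerProfile (1 / (2 + ρ)) 0 V P')
    {K₁ : ℝ} (hK₁ : ∀ y : EuclideanSpace ℝ (Fin 3), ‖V y‖ ≤ K₁ * (1 + ‖y‖))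
    {cA cE : ℝ} (hcA : 0 ≤ cA) (hcE : 0 ≤ cE)
    (hA : ∀ L : ℝ, 0 < L → ∫⁻ y in ball (0 : EuclideanSpace ℝ (Fin 3)) L, ‖V y‖ₑ ^ 2 ≤ ENNReal.ofReal (cA * L ^ (1 - 2 * ρ)))
    (hE : ∀ L : ℝ, 0 < L → ∫⁻ y in ball (0 : EuclideanSpace ℝ (Fin 3)) L, ‖fderiv ℝ V y‖ₑ ^ 2 ≤
      ENNReal.ofReal (cE * L ^ (1 - ρ)))
    {P : EuclideanSpace ℝ (Fin 3) → ℝ} (hPm : AEStronglyMeasurable P volume) {CD : ℝ≥0} {L₁ : ℝ}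
    (hD : ∀ R : ℝ, L₁ ≤ R → ∫⁻ y in ball (0 : EuclideanSpace ℝ (Fin 3)) R, ‖P y‖ₑ ^ (3 / 2 : ℝ) ≤
      CD * ENNReal.ofReal (R ^ (2 - 2 * ρ)))
    {c₀ : ℝ} (hc₀ : P =ᵐ[volume] fun y => P' y + c₀) (h : ℝ) :
    ∃ C' R₂ : ℝ, 0 < R₂ ∧ ∀ R : ℝ, R₂ ≤ R →
      volume ({y : EuclideanSpace ℝ (Fin 3) | h < selfSimilarBernoulli (1 / (2 + ρ)) 0 V P' y} ∩ {y | R ≤ ‖y‖}) ≤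
        ENNReal.ofReal (C' * R ^ (-(3 + 3 * ρ))) := by
  have h2ρ : (0 : ℝ) < 2 + ρ := by linarith
  have hγ : (0 : ℝ) < 1 / (2 + ρ) := one_div_pos.2 h2ρ
  have hγ2 : 1 / (2 + ρ) < 1 / 2 := one_div_lt_one_div_of_lt two_pos (by linarith)
  set a : ℝ := (Real.sqrt ((1 / (2 + ρ)) / 2) - 1 / (2 + ρ)) / 2 with hadef
  have hsq : 1 / (2 + ρ) < Real.sqrt ((1 / (2 + ρ)) / 2) := by
    rw [Real.lt_sqrt hγ.le]; nlinarith
  have ha : 0 < a := by rw [hadef]; linarith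
  set ε : ℝ := (1 / (2 + ρ)) * (1 - 2 * (1 / (2 + ρ))) / 4 with hεdef
  have hε : 0 < ε := by
    have h12 : 0 < 1 - 2 * (1 / (2 + ρ)) := by linarith
    rw [hεdef]; positivity
  have hV1 : ContDiff ℝ 1 V := hprof.contDiff_velocity.of_le (by norm_num)
  obtain ⟨K', hK'0, hfast⟩ := Loc.volume_fastSet_inter_far_le_sobolev (ρ := ρ) (by linarith) hV1 hcA hcE hA hE ha
  obtain ⟨K'', L₀, hK''0, hL₀, hpress⟩ :=
    Loc.volume_pressureHigh_inter_far_le_sobolev_of_growth (ρ := ρ) (by linarith) hprof hK₁ hcA hcE hA hE hPm hD hc₀ hε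
  obtain ⟨R₃, hR₃⟩ := Loc.norm_ge_of_bernoulliHigh_of_pressure_le hγ hγ2 V P' h
  have hL₀1 : 1 ≤ L₀ := (le_max_left _ _).trans hL₀
  refine ⟨K' + K'', max R₃ L₀, lt_of_lt_of_le one_pos (hL₀1.trans (le_max_right _ _)), fun R hR => ?_⟩
  have hRL₀ : L₀ ≤ R := (le_max_right _ _).trans hR
  have hR1 : 1 ≤ R := hL₀1.trans hRL₀
  have hR0 : 0 ≤ R := zero_le_one.trans hR1
  set A : Set (EuclideanSpace ℝ (Fin 3)) := {y | a * ‖y‖ ≤ ‖V y‖} ∩ {y | R ≤ ‖y‖} with hAset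
  set B : Set (EuclideanSpace ℝ (Fin 3)) := {y | ε * ‖y‖ ^ 2 < P' y} ∩ {y | R ≤ ‖y‖} with hBset
  have hsub : {y : EuclideanSpace ℝ (Fin 3) | h < selfSimilarBernoulli (1 / (2 + ρ)) 0 V P' y} ∩ {y | R ≤ ‖y‖} ⊆ A ∪ B := by
    rintro y ⟨hy, hyR⟩
    by_cases hPy : P' y ≤ ε * ‖y‖ ^ 2
    · exact Or.inl ⟨hR₃ y (((le_max_left _ _).trans hR).trans hyR) hPy hy, hyR⟩
    · exact Or.inr ⟨not_le.1 hPy, hyR⟩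
  have hnn1 : 0 ≤ K' * R ^ (-3 - 3 * ρ) := mul_nonneg hK'0 (Real.rpow_nonneg hR0 _)
  have hnn2 : 0 ≤ K'' * R ^ (-3 - 3 * ρ) := mul_nonneg hK''0 (Real.rpow_nonneg hR0 _)
  calc volume ({y : EuclideanSpace ℝ (Fin 3) | h < selfSimilarBernoulli (1 / (2 + ρ)) 0 V P' y} ∩ {y | R ≤ ‖y‖})
      ≤ volume (A ∪ B) := measure_mono hsub
    _ ≤ volume A + volume B := measure_union_le _ _
    _ ≤ ENNReal.ofReal (K' * R ^ (-3 - 3 * ρ)) + ENNReal.ofReal (K'' * R ^ (-3 - 3 * ρ)) :=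
        add_le_add (hfast R hR1) (hpress R hRL₀)
    _ = ENNReal.ofReal ((K' + K'') * R ^ (-(3 + 3 * ρ))) := by
        rw [← ENNReal.ofReal_add hnn1 hnn2, show -(3 + 3 * ρ) = -3 - 3 * ρ by ring, add_mul]

/-! ### The sharp Sobolev past-exact / shifted twin -/

namespace Past

variable {ρ T T₁ : ℝ} {x₀ : EuclideanSpace ℝ (Fin 3)}
  {u : ℝ → EuclideanSpace ℝ (Fin 3) → EuclideanSpace ℝ (Fin 3)} {p : ℝ → EuclideanSpace ℝ (Fin 3) → ℝ}
  {H : ℝ → EuclideanSpace ℝ (Fin 3) → EuclideanSpace ℝ (Fin 3) →L[ℝ] EuclideanSpace ℝ (Fin 3)} {c : ℝ≥0}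
  {V : EuclideanSpace ℝ (Fin 3) → EuclideanSpace ℝ (Fin 3)} {P : EuclideanSpace ℝ (Fin 3) → ℝ}

/-- **Past-exact member, `C²` profile of linear growth with a FAR VORTICAL CHANNEL OF RATE `c₁ > 1/((2+ρ)(1+ρ))` for every classical pressure: the profile
is ZERO** (`0 < ρ ≤ ½`; exact self-similarity about `(T, x₀)` for `τ < T₁ ≤ min 0 T`; no pressure clause; the `E`-gauge is now used — Sobolev thinness).
[folklore; GNS inequality] -/
theorem profile_eq_zero_of_vorticalFastChannelC2_sharp (hρ : 0 < ρ) (hρh : ρ ≤ 1 / 2) (hT₁ : T₁ ≤ 0) (hTT₁ : T₁ ≤ T)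
    (hsol : IsDistributionalNSSolutionOn (slab (EuclideanSpace ℝ (Fin 3)) (Iio 0) isOpen_Iio) 0 0 u p)
    (hH : HasWeakSpatialGradientOn (slab (EuclideanSpace ℝ (Fin 3)) (Iio 0) isOpen_Iio) u H)
    (hA : ∀ a : ℝ, 0 < a → ENNReal.ofReal (a ^ (2 * ρ)) *
      cknA a (0 : ℝ × EuclideanSpace ℝ (Fin 3)) u ≤ (c : ℝ≥0∞))
    (hE : ∀ a : ℝ, 0 < a → ENNReal.ofReal (a ^ ρ) *
      cknE a (0 : ℝ × EuclideanSpace ℝ (Fin 3)) H ≤ (c : ℝ≥0∞))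
    (hD : ∀ a : ℝ, 0 < a → ENNReal.ofReal (a ^ (2 * ρ)) *
      cknD a (0 : ℝ × EuclideanSpace ℝ (Fin 3)) p ≤ (c : ℝ≥0∞))
    (hu : ∀ τ : ℝ, τ < T₁ → u τ = fun x => selfSimilarCollapse (1 / (2 + ρ)) T V τ (x - x₀))
    (hp : ∀ τ : ℝ, τ < T₁ → p τ = fun x => selfSimilarCollapsePressure (1 / (2 + ρ)) T P τ (x - x₀))
    (hV : ContDiff ℝ 2 V) {K₁ : ℝ} (hK₁ : ∀ y : EuclideanSpace ℝ (Fin 3), ‖V y‖ ≤ K₁ * (1 + ‖y‖))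
    {c₁ : ℝ} (hc₁ : 1 / ((2 + ρ) * (1 + ρ)) < c₁)
    (hB : ∀ P' : EuclideanSpace ℝ (Fin 3) → ℝ, IsSelfSimilarEulerProfile (1 / (2 + ρ)) 0 V P' →
      ∀ h : ℝ, ∃ R₀ : ℝ, ∀ y : EuclideanSpace ℝ (Fin 3), R₀ ≤ ‖y‖ →
        h < selfSimilarBernoulli (1 / (2 + ρ)) 0 V P' y → curl V y ≠ 0 →
          ⟪y, selfSimilarTransport (1 / (2 + ρ)) 0 V y⟫ ≤ -(c₁ * ‖y‖ ^ 2)) : V = 0 := by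
  -- adapted from `Past.profile_eq_zero_of_vorticalSuperFastChannelC2` (…SqueezeSharpPast, ns-ezl-w5 g0)
  have hρ1' : ρ < 1 := by linarith
  have h2ρ : (0 : ℝ) < 2 + ρ := by linarith
  have hγ : (0 : ℝ) < 1 / (2 + ρ) := one_div_pos.2 h2ρ
  have hγ2 : 1 / (2 + ρ) < 1 / 2 := one_div_lt_one_div_of_lt two_pos (by linarith)
  -- the far-past extension and its dictionary
  have hext := Shifted.isDistributional_selfSimilarCollapse_of_past hT₁ hTT₁ x₀ hsol hu hp
  have hpmE : AEStronglyMeasurable (uncurry (selfSimilarCollapsePressure (1 / (2 + ρ)) 0 P))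
      (volume.restrict (Iio (0 : ℝ) ×ˢ (univ : Set (EuclideanSpace ℝ (Fin 3))))) := by
    have := hext.2.2.1.aestronglyMeasurable
    simpa [slab] using this
  have hPm : AEStronglyMeasurable P volume :=
    aestronglyMeasurable_pressureProfile (p := selfSimilarCollapsePressure (1 / (2 + ρ)) 0 P) hpmE fun _ _ => rfl
  have hP1 : LocallyIntegrable P volume :=
    Shifted.locallyIntegrable_pressureProfile_of_slab hγ.le (by linarith) hPm hext.2.2.1
  obtain ⟨P', hprof⟩ := exists_isSelfSimilarEulerProfile hρ hT₁ hTT₁ hsol hu hp hV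
  have hfast := hB P' hprof
  -- the bridge on the extension: `P = P' + c₀` a.e.
  obtain ⟨c₀, hc₀⟩ := WeakToClassical.pressureProfile_ae_eq_add_const hext (fun _ _ => rfl) (fun _ _ => rfl) hV hP1 hprof
  -- `A`-growth of the profile: large scales from the gauge, then all scales (continuity), real constant
  obtain ⟨CA, hCA, hgrowth⟩ := Shifted.profile_energy_growth_of_gaugeA_past hρ hρh hT₁ hTT₁ x₀ hu hA
  obtain ⟨cA, hcA, hA'⟩ := Loc.real_growth_of_growth_le hV.continuous (θ := 1 - 2 * ρ) (by linarith)
    (L₀ := 2 - T₁) (by linarith) hCA hgrowth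
  -- `E`-growth of the profile gradient (ns-ezl-w2 g3), then all scales
  have hV1 : ContDiff ℝ 1 V := hV.of_le (by norm_num)
  obtain ⟨CE, hCE, hEgr⟩ := NeedleRace.lintegral_fderiv_sq_ball_le_of_past hρ hρ1' hT₁ hTT₁ x₀ hH hu hE hV1
  obtain ⟨cE, hcE, hE'⟩ := Loc.real_growth_of_growth_le (hV1.continuous_fderiv one_ne_zero) (θ := 1 - ρ) (by linarith)
    (L₀ := 2 - T₁) (by linarith) hCE hEgr
  -- `D`-growth of the member's pressure profile
  have hpm : AEStronglyMeasurable (uncurry p)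
      (volume.restrict (Iio (0 : ℝ) ×ˢ (univ : Set (EuclideanSpace ℝ (Fin 3))))) := by
    have := hsol.2.2.1.aestronglyMeasurable
    simpa [slab] using this
  obtain ⟨CD, hCD, hDgrowth⟩ := profile_pressure_growth_of_gaugeD_past hρ hρ1' hT₁ hTT₁ x₀ hpm hp hD
  have hD' : ∀ L : ℝ, 2 - T₁ ≤ L → ∫⁻ y in ball (0 : EuclideanSpace ℝ (Fin 3)) L, ‖P y‖ₑ ^ (3 / 2 : ℝ) ≤
      (CD.toNNReal : ℝ≥0∞) * ENNReal.ofReal (L ^ (2 - 2 * ρ)) := by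
    intro L hL; rw [ENNReal.coe_toNNReal hCD]; exact hDgrowth L hL
  -- SOBOLEV THINNESS of the high sets of `ℋ_{P'}`, rate `3 + 3ρ`, no pressure clause
  have hthin : ∀ h : ℝ, ∃ C R₂ : ℝ, 0 < R₂ ∧ ∀ R : ℝ, R₂ ≤ R →
      volume ({y : EuclideanSpace ℝ (Fin 3) | h < selfSimilarBernoulli (1 / (2 + ρ)) 0 V P' y} ∩ {y | R ≤ ‖y‖}) ≤
        ENNReal.ofReal (C * R ^ (-(3 + 3 * ρ))) := fun h =>
    Loc.volume_bernoulliHigh_inter_far_le_sobolev_of_growth hρ hprof hK₁ hcA hcE hA' hE' hPm hD' hc₀ h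
  -- the race `3γ < c₁ (3 + 3ρ)`, i.e. `1 < c₁ (2+ρ)(1+ρ)`
  have hrace : 3 * (1 / (2 + ρ)) < c₁ * (3 + 3 * ρ) := by
    have h1ρ : (0 : ℝ) < 1 + ρ := by linarith
    have h1 := (div_lt_iff₀ (by positivity : (0 : ℝ) < (2 + ρ) * (1 + ρ))).1 hc₁
    rw [show 3 * (1 / (2 + ρ)) = 3 / (2 + ρ) by ring, div_lt_iff₀ h2ρ]
    nlinarith
  have hc₁0 : 0 < c₁ := lt_trans (by positivity) hc₁
  have hcurl : ∀ x, curl V x = 0 := fun x =>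
    Loc.curl_eq_zero_of_vorticalFastChannel_of_thin hprof hγ hγ2 hK₁ hc₁0 hrace hthin hfast x
  exact profile_eq_zero_of_irrotationalC2 hρ hρh hT₁ hTT₁ hsol hA hu hp hV hcurl

/-- **PAST-EXACT MEMBER WHOSE `C²` PROFILE OF LINEAR GROWTH HAS A FAR VORTICAL BERNOULLI CHANNEL OF RATE `c₁ > 1/((2+ρ)(1+ρ))` IS TRIVIAL — NO PRESSURE
CLAUSE** (crux hypotheses verbatim, `0 < ρ ≤ ½`, exact self-similarity about `(T, x₀)` for `τ < T₁`, `T₁ ≤ 0`, `T₁ ≤ T`; `V ∈ C²`, `‖V y‖ ≤ K₁(1+‖y‖)`;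
for every classical pressure `P′` of `V` and every level `h` a radius beyond which every VORTICAL point of `{ℋ_{P′} > h}` has `⟪y, γy + V y⟫ ≤ −c₁‖y‖²`).
The past twin of the LEAD's `Loc.selfSimilar_ae_eq_zero_of_vorticalFastChannelC2_profile_sharp` and the threshold-lowered successor of
`Past.selfSimilar_ae_eq_zero_of_vorticalSuperFastChannelC2_profile_past` (same argument list). [folklore; GNS inequality] -/
theorem selfSimilar_ae_eq_zero_of_vorticalFastChannelC2_profile_sharp_past (hρ : 0 < ρ) (hρh : ρ ≤ 1 / 2) (hT₁ : T₁ ≤ 0)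
    (hTT₁ : T₁ ≤ T) (x₀ : EuclideanSpace ℝ (Fin 3))
    (hsw : IsSuitableWeakSolutionOn (slab (EuclideanSpace ℝ (Fin 3)) (Iio 0) isOpen_Iio) 0 0 u p)
    (hH : HasWeakSpatialGradientOn (slab (EuclideanSpace ℝ (Fin 3)) (Iio 0) isOpen_Iio) u H)
    (hgauge : ∀ a : ℝ, 0 < a →
      ENNReal.ofReal (a ^ (2 * ρ)) * cknA a (0 : ℝ × EuclideanSpace ℝ (Fin 3)) u +
          ENNReal.ofReal (a ^ ρ) * cknE a (0 : ℝ × EuclideanSpace ℝ (Fin 3)) H +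
        ENNReal.ofReal (a ^ (2 * ρ)) * cknD a (0 : ℝ × EuclideanSpace ℝ (Fin 3)) p ≤ (c : ℝ≥0∞))
    (hu : ∀ τ : ℝ, τ < T₁ → u τ = fun x => selfSimilarCollapse (1 / (2 + ρ)) T V τ (x - x₀))
    (hp : ∀ τ : ℝ, τ < T₁ → p τ = fun x => selfSimilarCollapsePressure (1 / (2 + ρ)) T P τ (x - x₀))
    (hV : ContDiff ℝ 2 V) {K₁ : ℝ} (hK₁ : ∀ y : EuclideanSpace ℝ (Fin 3), ‖V y‖ ≤ K₁ * (1 + ‖y‖))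
    {c₁ : ℝ} (hc₁ : 1 / ((2 + ρ) * (1 + ρ)) < c₁)
    (hB : ∀ P' : EuclideanSpace ℝ (Fin 3) → ℝ, IsSelfSimilarEulerProfile (1 / (2 + ρ)) 0 V P' →
      ∀ h : ℝ, ∃ R₀ : ℝ, ∀ y : EuclideanSpace ℝ (Fin 3), R₀ ≤ ‖y‖ →
        h < selfSimilarBernoulli (1 / (2 + ρ)) 0 V P' y → curl V y ≠ 0 →
          ⟪y, selfSimilarTransport (1 / (2 + ρ)) 0 V y⟫ ≤ -(c₁ * ‖y‖ ^ 2)) :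
    uncurry u =ᵐ[volume.restrict (Iio (0 : ℝ) ×ˢ (univ : Set (EuclideanSpace ℝ (Fin 3))))] 0 :=
  have hA : ∀ a : ℝ, 0 < a → ENNReal.ofReal (a ^ (2 * ρ)) *
      cknA a (0 : ℝ × EuclideanSpace ℝ (Fin 3)) u ≤ (c : ℝ≥0∞) :=
    fun a ha => le_trans (le_trans le_self_add le_self_add) (hgauge a ha)
  have hE : ∀ a : ℝ, 0 < a → ENNReal.ofReal (a ^ ρ) *
      cknE a (0 : ℝ × EuclideanSpace ℝ (Fin 3)) H ≤ (c : ℝ≥0∞) :=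
    fun a ha => le_trans (le_trans le_add_self le_self_add) (hgauge a ha)
  have hD : ∀ a : ℝ, 0 < a → ENNReal.ofReal (a ^ (2 * ρ)) *
      cknD a (0 : ℝ × EuclideanSpace ℝ (Fin 3)) p ≤ (c : ℝ≥0∞) :=
    fun a ha => le_trans le_add_self (hgauge a ha)
  ae_eq_zero_of_profile_eq_zero hρ.le hsw hH hgauge hu
    (profile_eq_zero_of_vorticalFastChannelC2_sharp hρ hρh hT₁ hTT₁ hsw.distributional hH hA hE hD hu hp hV hK₁ hc₁ hB)

end Past

end Summit.NavierStokesRegularity.NavierStokesRegularity.Theorems.PowerGaugeEulerLiouville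

end
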